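import Literature.NumberTheory.EllipticCurves.SemilinearTateDualPlaces
import Literature.NumberTheory.EllipticCurves.WeilPairingTateDual
import Summits.BirchSwinnertonDyer.BirchSwinnertonDyer.Theorems.Rank1ResidualJetSemilinearNaturality
import HarnessLib

/-!
# T1 JET (cell `bsd-jet`), road K, stub S1 ↔ self-duality: the Weil transport `E[n] → E[n]^D`
# intertwines `conjAct` with `conjActDual` (and `conjActPlace` with `conjActPlaceDual`) for a Weil
# pairing equivariant under the lift of `σ`

HONEST FRAMING (programme file `BSD-LIT2PART-PROGRAMME-v1.md` §HONESTY, verbatim): «no tranche here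
proves BSD; ARM L moves the LITERAL column of an r ≤ 1 census into the kernel-proved-modulo-named-print
column; ARM P changes what «named print» is worth.» THEOREMS ONLY (seat `bsd-jet-pv-1`, session g4;
`--supports stmt-BirchSwinnertonDyer-14418`, helper): no definition, no named fact, no `sorry`.
Nothing is booked; 0 classes move.

## What (the bridge SD1 of sheet `PV1-ROADK-S1.md` §v2, modulo the `τ`-equivariance of the pairing)

For `E = W/ℚ` over `K`, a biadditive `μ_N`-valued `Γ_K`-equivariant pairing `e` on `E[N]` (tree
`weilDualIntertwining`: `T ↦ e(·, T) : E[N] → E[N]^D`) which is ALSO equivariant under a lift `τ` of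
`σ ∈ Aut(K/ℚ)` — hypothesis `hτe : τ (e S T) = e (τ S) (τ T)` (true for THE Weil pairing of a curve over
`ℚ`, Silverman III.8.1 (d) applied over `ℚ`; the tree's datum `e` carries `Γ_K`-equivariance only):

* `weilDualHom_torsionMap` — `w(τ T) = τ ∘ w(T) ∘ τ⁻¹` (`tateDualTorsionSemilinearMap`);
* `map_weilDual_conjAct` — **`H¹(w) ∘ conjAct = conjActDual ∘ H¹(w)`** on `H¹(K, E[N])`;
* `map_weilDual_conjActPlace` — **`H¹(w|_{K_w}) ∘ conjActPlace = conjActPlaceDual ∘ H¹(w|_{K_v})`**.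

With X11b's `WeilTransport` (bijectivity of `H¹(w)`, `localTatePairingZMod_map_weilDual`) and n1011's
`KummerSelfDualCount` (Kummer structure self-dual) these carry the signed Poitou–Tate counting
(`Rank1ResidualJetSignedGlobalDuality`, dual side in `H¹(K, E[N]^D)`) to the `H¹(K, E[N])`-currency of
`JET.tamagawaExponent_le_mInfty_of_rowData` (`hdual_q`, `hdual_ℓ`).
References (locators only): [cite: SilvermanAEC2009, Prop. III.8.1 (d)] [cite: Jetchev2008, §5 Thm. 5.1]
[cite: MilneADT2006, Ch. I §6]. Design: no definitions. Axioms: `propext`, `Classical.choice`, `Quot.sound`.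
-/

set_option autoImplicit false

noncomputable section

open scoped Classical ContRepresentation
open Field WeierstrassCurve NumberField IsDedekindDomain
open Literature.NumberTheory.EllipticCurves Literature.NumberTheory.GaloisRepresentations
open Literature.NumberTheory.GaloisRepresentations.DiscreteGaloisModule (MuCarrier TateDual)

universe u

namespace Summit.BirchSwinnertonDyer.Rank1Residual.JET.GlobalDuality

section WeilConj

variable {K : Type u} [Field K] [NumberField K] (W : WeierstrassCurve ℚ) (σ : K ≃ₐ[ℚ] K)
  (N : ℕ) [NeZero N] [(W.baseChange K).IsElliptic] [Finite (geomTorsion (W.baseChange K) N)]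
  (e : geomTorsion (W.baseChange K) N → geomTorsion (W.baseChange K) N → AlgebraicClosure K)
  (hμ : ∀ S T, e S T ^ N = 1)
  (hadd₁ : ∀ S₁ S₂ T, e (S₁ + S₂) T = e S₁ T * e S₂ T)
  (hadd₂ : ∀ S T₁ T₂, e S (T₁ + T₂) = e S T₁ * e S T₂)
  (hgal : ∀ (g : absoluteGaloisGroup K) (S T : geomTorsion (W.baseChange K) N),
    g • e S T = e (g • S) (g • T))

omit [(W.baseChange K).IsElliptic] [Finite (geomTorsion (W.baseChange K) N)] in
/-- **The Weil dual map intertwines `τ` on points with `τ ∘ (·) ∘ τ⁻¹` on `Hom(E[N], μ_N)`** for a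
pairing equivariant under the lift `τ`: `w(τT)(S) = e(S, τT) = τ e(τ⁻¹S, T) = (τ ∘ w(T) ∘ τ⁻¹)(S)`.
[cite: SilvermanAEC2009, Prop. III.8.1 (d)] -/
theorem weilDualHom_torsionMap {τ : AlgebraicClosure K ≃+* AlgebraicClosure K}
    (hτ : IsLiftOfAut σ τ)
    (hτe : ∀ S T, τ (e S T) = e (hτ.torsionMap W N S) (hτ.torsionMap W N T))
    (T : geomTorsion (W.baseChange K) N) :
    weilDualHom (W.baseChange K) N e hμ hadd₁ hadd₂ (hτ.torsionMap W N T) =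
      tateDualTorsionSemilinearMap W σ N N hτ (weilDualHom (W.baseChange K) N e hμ hadd₁ hadd₂ T) := by
  refine DiscreteGaloisModule.TateDual.ext fun S => ?_
  rw [weilDualHom_apply_apply]
  change _ = muSemilinearMap τ N (weilDualHom (W.baseChange K) N e hμ hadd₁ hadd₂ T
    (hτ.symm_isLiftOfAut.torsionMap W N S))
  rw [weilDualHom_apply_apply]
  apply MuCarrier.eq_of_coe_eq
  rw [coe_weilPairingHom, coe_muSemilinearMap, coe_weilPairingHom, hτe, hτ.torsionMap_apply_symm]

/-- **`H¹(w) ∘ conjAct = conjActDual ∘ H¹(w)`**: the Weil transport on `H¹(K, ·)` carries the action of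
`σ` on `H¹(K, E[N])` to the action on `H¹(K, E[N]^D)` (`map_semilinearH` + `weilDualHom_torsionMap`;
`conjAct` computed with the lift `liftAut σ` used by `conjActDual`). [cite: Jetchev2008, §5 Thm. 5.1]
[cite: SilvermanAEC2009, Prop. III.8.1 (d)] -/
theorem map_weilDual_conjAct
    (hτe : ∀ S T, liftAut σ (e S T) =
      e ((isLiftOfAut_liftAut σ).torsionMap W N S) ((isLiftOfAut_liftAut σ).torsionMap W N T))
    (x : galH1Torsion (W.baseChange K) N) :
    galoisCohomology.map (weilDualIntertwining (W.baseChange K) N e hμ hadd₁ hadd₂ hgal) 1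
        (conjAct W σ N x) =
      conjActDual W σ N N (galoisCohomology.map
        (weilDualIntertwining (W.baseChange K) N e hμ hadd₁ hadd₂ hgal) 1 x) := by
  rw [← (isLiftOfAut_liftAut σ).conjH1_eq_conjAct W N,
    ← semilinearH_one_eq_conjH1 W (isLiftOfAut_liftAut σ) N]
  exact map_semilinearH (isLiftOfAut_liftAut σ)
    (weilDualIntertwining (W.baseChange K) N e hμ hadd₁ hadd₂ hgal)
    ((isLiftOfAut_liftAut σ).torsionMap_smul W N) (isSemilinear_tateDualTorsion W σ N N _)
    (fun T => weilDualHom_torsionMap W σ N e hμ hadd₁ hadd₂ (isLiftOfAut_liftAut σ) hτe T) 1 x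

/-- **`H¹(w|_{K_w}) ∘ conjActPlace = conjActPlaceDual ∘ H¹(w|_{K_v})`** at a place datum `σ • v = w`
(`map_semilinearLocalH` with the adapted lift `liftAutPlace σ h`, which both place actions use).
[cite: Jetchev2008, §5 Thm. 5.1] [cite: SilvermanAEC2009, Prop. III.8.1 (d)] -/
theorem map_weilDual_conjActPlace {v w : HeightOneSpectrum (𝓞 K)} (h : σ • v = w)
    (hτe : ∀ S T, liftAutPlace σ h (e S T) =
      e ((isLiftOfAut_liftAutPlace σ h).torsionMap W N S)
        ((isLiftOfAut_liftAutPlace σ h).torsionMap W N T))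
    (x : galoisCohomology (((W.baseChange K).torsionGaloisModule N).toLocal (Sum.inr v : Place K)) 1) :
    galoisCohomology.map ((weilDualIntertwining (W.baseChange K) N e hμ hadd₁ hadd₂ hgal).restrictField
        (w.adicCompletion K)) 1 (conjActPlace W σ N h x) =
      conjActPlaceDual W σ N N h (galoisCohomology.map
        ((weilDualIntertwining (W.baseChange K) N e hμ hadd₁ hadd₂ hgal).restrictField
          (v.adicCompletion K)) 1 x) :=
  map_semilinearLocalH (E := v.adicCompletion K) (E' := w.adicCompletion K)
    (isLiftOfAut_liftAutPlace σ h)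
    (isLiftOfRingEquiv_ringEquivLift (Literature.NumberTheory.Automorphic.galAdicCompletionEquiv
      (L := K) σ h))
    (liftsCommute_liftAutPlace σ h) (weilDualIntertwining (W.baseChange K) N e hμ hadd₁ hadd₂ hgal)
    ((isLiftOfAut_liftAutPlace σ h).torsionMap_smul W N) (isSemilinear_tateDualTorsion W σ N N _)
    (fun T => weilDualHom_torsionMap W σ N e hμ hadd₁ hadd₂ (isLiftOfAut_liftAutPlace σ h) hτe T) 1 x

end WeilConj

end Summit.BirchSwinnertonDyer.Rank1Residual.JET.GlobalDuality

end
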